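import Summits.BirchSwinnertonDyer.Rank1Residual.GaloisImage.PrimeChoiceCovering
import Literature.NumberTheory.GaloisCohomology.KolyvaginSystems
import Literature.NumberTheory.GaloisRepresentations.CyclotomicLevels
import Literature.NumberTheory.GaloisRepresentations.ContinuousH1
import HarnessLib

/-!
# The prime-choice selection: `γ ∈ Gal(K̄/K(T̄, μ_N))` with `cᵢ(τγ) ∉ (τ − 1)T̄` for `n ≤ p` classes
# (cell `b2b-bsdres`, team n1011, row T-C55K, file 2/5 — COCYCLE ALGEBRA over any field; seat p15)

HONEST FRAMING (cell `b2b-bsdres`, run/shared/lean/b2b/bsd-rank1-residual/, verbatim in every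
file): the goal of the cell is to DELETE the COMBINATION-SHAPED residual classes of the
Birch–Swinnerton-Dyer formula for ALL analytic-rank `≤ 1` elliptic curves over `ℚ` — "full BSD
formula for every rank `≤ 1` curve in class `C`" assembled STRICTLY from published theorems — so
that the rank-`≤ 1` remainder becomes exactly the CONSTRUCTION-SHAPED classes, which are TYPED
(missing-input `Prop`s), NOT attempted. This is not "finishing BSD". Team n1011 (N10/N11, the
additive block `X4 ∧ p = 3`): research route; TOOL theorems about continuous crossed homomorphisms
of a finite Galois module, no class theorem, nothing booked, no mark changed; no definition, no
named fact.

## What and why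

This is the group-theoretic half of Sakamoto's Lemma 5.2 (JTNB 36 (2024), p. 928) = the part of
the proof of Mazur–Rubin's Prop. 3.6.1 (Mem. AMS 799, pp. 30–31) that precedes the Chebotarev
density theorem, at ANY prime `p` and for `n ≤ p` classes (Mazur–Rubin: `n = 4`, `p ≥ 5` via
(H.4b); Sakamoto: `n = 3`, `p = 3`).  Setting (any field `K`): a discrete `Γ_K`-module `ρ` on `M`
("`T̄`"), `N : ℕ`, the subgroup `G_F = ker ρ ⊓ Gal(K̄/K(μ_N))` (`F = K(T̄, μ_N)`; tree
`ContinuousRep.ker`, `rootsOfUnityFixer`), `τ ∈ Γ_K` with `T̄/(τ − 1)T̄ ≃ ℤ/p` (tree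
`cokerSubOne`, the (H.2) shape), and the hypotheses

* (H.1) `hirr` — `T̄` has no `ρ`-stable subgroup other than `⊥`, `⊤`;
* (H.3) `hH3` — every continuous crossed homomorphism vanishing on `G_F` is principal (VERBATIM the
  shape of `InflationRestrictionSakamotoH3`, discharged there for `E[p]`, `p` odd, `ρ̄` onto).

Content:
* `apply_mul_of_apply_eq_one`, `apply_inv_of_apply_eq_one`, `apply_conj_of_apply_eq_one` — on
  `ker ρ` a crossed homomorphism is a homomorphism, and `c(s g s⁻¹) = ρ(s) c(g)` (Mazur–Rubin p. 31:
  "the restriction of `c_i` to `F` … a `G_ℚ`-equivariant homomorphism");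
* `oneCocycleClass_eq_zero_of_forall_apply_mem_range` — THE KEY LEMMA: if `c(g) ∈ (τ − 1)T̄` for
  every `g ∈ G_F` then `[c] = 0` ((H.1): the image `c(G_F)` is a stable subgroup inside the proper
  subgroup `(τ − 1)T̄`, hence `0`; then (H.3));
* `exists_forall_apply_mul_notMem_range` — THE SELECTION: for cocycles `c₁ … cₙ`, `n ≤ p`, with
  non-zero classes there is `γ ∈ G_F` with `cᵢ(τγ) ∉ (τ − 1)T̄` for all `i` (file 1's selection
  lemma applied to `F eᵢ = (cᵢ|_{G_F}) mod (τ − 1)T̄` and `Λ eᵢ = cᵢ(τ) mod (τ − 1)T̄`, using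
  `cᵢ(τγ) ≡ cᵢ(τ) + cᵢ(γ)`).

References: B. Mazur, K. Rubin, *Kolyvagin systems*, Mem. AMS 799 (2004), Prop. 3.6.1, pp. 30–31;
R. Sakamoto, *The theory of Kolyvagin systems for p = 3*, JTNB 36 (2024), Lemma 5.2 (p. 928).
-/

noncomputable section

open Function
open Literature.NumberTheory.GaloisRepresentations Literature.NumberTheory.GaloisCohomology

universe u

namespace Summit.BirchSwinnertonDyer.Rank1Residual.GaloisImage.PrimeChoice

variable {K : Type u} [Field K] {M : Type u} [AddCommGroup M] [TopologicalSpace M]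
  [DiscreteTopology M] {ρ : DiscreteGaloisModule K M}

/-! ## Crossed homomorphisms restricted to `ker ρ` -/

/-- On `ker ρ` a crossed homomorphism is additive in the first variable:
`c(g h) = c(g) + c(h)` when `ρ g = 1`. [cite: MazurRubin2004, Prop. 3.6.1 proof, p. 31] -/
theorem apply_mul_of_apply_eq_one (c : contOneCocycles ρ.toTopRep) {g : Field.absoluteGaloisGroup K}
    (hg : ρ g = 1) (h : Field.absoluteGaloisGroup K) : c.1 (g * h) = c.1 g + c.1 h := by
  rw [c.2 g h]
  change c.1 g + ρ g (c.1 h) = _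
  rw [hg, Module.End.one_apply]

/-- `c(g⁻¹) = −c(g)` when `ρ g = 1`. [cite: MazurRubin2004, Prop. 3.6.1 proof, p. 31] -/
theorem apply_inv_of_apply_eq_one (c : contOneCocycles ρ.toTopRep) {g : Field.absoluteGaloisGroup K}
    (hg : ρ g = 1) : c.1 g⁻¹ = -c.1 g := by
  have h := apply_mul_of_apply_eq_one c hg g⁻¹
  rw [mul_inv_cancel, contOneCocycles.apply_one] at h
  exact (neg_eq_of_add_eq_zero_right h.symm).symm

/-- **Equivariance**: `c(s g s⁻¹) = ρ(s) c(g)` when `ρ g = 1` (the restriction of a cocycle to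
`ker ρ` is a `Γ_K`-equivariant homomorphism). [cite: MazurRubin2004, Prop. 3.6.1 proof, p. 31] -/
theorem apply_conj_of_apply_eq_one (c : contOneCocycles ρ.toTopRep)
    {g : Field.absoluteGaloisGroup K} (hg : ρ g = 1) (s : Field.absoluteGaloisGroup K) :
    c.1 (s * g * s⁻¹) = ρ s (c.1 g) := by
  have h1 : c.1 (s * g * s⁻¹) = c.1 s + ρ s (c.1 (g * s⁻¹)) := by
    rw [mul_assoc, c.2 s (g * s⁻¹)]; rfl
  have h2 : c.1 (s * s⁻¹) = c.1 s + ρ s (c.1 s⁻¹) := c.2 s s⁻¹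
  rw [mul_inv_cancel, contOneCocycles.apply_one] at h2
  rw [h1, apply_mul_of_apply_eq_one c hg, map_add, ← add_assoc, add_comm (c.1 s), add_assoc, ← h2,
    add_zero]

/-- `Gal(K̄/K(μ_N))` is normal in `Γ_K` (no hypothesis on `N`): `(s g s⁻¹) t = s g (s⁻¹ t) = t`
for `t ^ N = 1`. [folklore] -/
theorem conj_mem_rootsOfUnityFixer {N : ℕ} {g : Field.absoluteGaloisGroup K}
    (hg : g ∈ rootsOfUnityFixer K N) (s : Field.absoluteGaloisGroup K) :
    s * g * s⁻¹ ∈ rootsOfUnityFixer K N := by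
  rw [mem_rootsOfUnityFixer_iff] at hg ⊢
  intro t ht
  have ht' : (s⁻¹ • t) ^ N = 1 := by rw [← smul_pow', ht, smul_one]
  rw [mul_smul, mul_smul, hg _ ht', smul_inv_smul]

/-! ## The key lemma: values on `G_F` inside `(τ − 1)T̄` force a principal cocycle -/

/-- The subgroup `(τ − 1)T̄ = range (ρ τ − 1)` is proper when `T̄/(τ − 1)T̄ ≃ ℤ/p`.
[cite: Sakamoto2024, §2 (H.2) (p. 921)] -/
theorem range_sub_id_ne_top {p : ℕ} [Fact p.Prime] {τ : Field.absoluteGaloisGroup K}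
    (e : cokerSubOne ρ τ ≃+ ZMod p) :
    ((ρ τ).toAddMonoidHom - AddMonoidHom.id M).range ≠ ⊤ := by
  intro htop
  have h01 : (e.symm 0 : cokerSubOne ρ τ) = e.symm 1 := by
    obtain ⟨a, ha⟩ := QuotientAddGroup.mk_surjective (e.symm 0)
    obtain ⟨b, hb⟩ := QuotientAddGroup.mk_surjective (e.symm 1)
    rw [← ha, ← hb, QuotientAddGroup.eq]
    rw [htop]; exact AddSubgroup.mem_top _
  exact zero_ne_one (e.symm.injective h01)

/-- **KEY LEMMA.** Under (H.1) and (H.3): if a continuous crossed homomorphism `c : Γ_K → T̄`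
takes values in `(τ − 1)T̄` on `G_F = ker ρ ⊓ Gal(K̄/K(μ_N))`, and `T̄/(τ − 1)T̄ ≃ ℤ/p`, then
`[c] = 0`.  (The image `c(G_F)` is a `ρ`-stable subgroup by `apply_conj_of_apply_eq_one`, proper
because it lies in `(τ − 1)T̄`, hence trivial by (H.1); then (H.3).)  This is the step "since `T̄`
is irreducible, `c̄_i(G_F)` generates `T̄`, so is not contained in `(τ − 1)T̄`" of Mazur–Rubin's
proof of Prop. 3.6.1. [cite: MazurRubin2004, Prop. 3.6.1 proof, p. 31]
[cite: Sakamoto2024, Lemma 5.2 (p. 928)] -/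
theorem oneCocycleClass_eq_zero_of_forall_apply_mem_range {p : ℕ} [Fact p.Prime] {N : ℕ}
    {τ : Field.absoluteGaloisGroup K} (e : cokerSubOne ρ τ ≃+ ZMod p)
    (hirr : ∀ A : AddSubgroup M,
      (∀ (s : Field.absoluteGaloisGroup K), ∀ m ∈ A, ρ s m ∈ A) → A = ⊥ ∨ A = ⊤)
    (hH3 : ∀ f : contOneCocycles ρ.toTopRep,
      (∀ u : Field.absoluteGaloisGroup K, ρ u = 1 → u ∈ rootsOfUnityFixer K N → f.1 u = 0) →
        oneCocycleClass ρ.toTopRep f = 0)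
    (c : contOneCocycles ρ.toTopRep)
    (hc : ∀ g : Field.absoluteGaloisGroup K, ρ g = 1 → g ∈ rootsOfUnityFixer K N →
      c.1 g ∈ ((ρ τ).toAddMonoidHom - AddMonoidHom.id M).range) :
    oneCocycleClass ρ.toTopRep c = 0 := by
  -- the image of `G_F` under `c`, a `ρ`-stable subgroup
  let A : AddSubgroup M :=
    { carrier := {m | ∃ g : Field.absoluteGaloisGroup K, ρ g = 1 ∧ g ∈ rootsOfUnityFixer K N ∧
        c.1 g = m}
      zero_mem' := ⟨1, map_one ρ, Subgroup.one_mem _, contOneCocycles.apply_one c⟩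
      add_mem' := by
        rintro _ _ ⟨g, hg, hgμ, rfl⟩ ⟨h, hh, hhμ, rfl⟩
        exact ⟨g * h, by rw [map_mul, hg, hh, mul_one], Subgroup.mul_mem _ hgμ hhμ,
          apply_mul_of_apply_eq_one c hg h⟩
      neg_mem' := by
        rintro _ ⟨g, hg, hgμ, rfl⟩
        have hinv : ρ g⁻¹ = 1 := by
          have h := map_mul ρ g⁻¹ g
          rw [inv_mul_cancel, map_one, hg, mul_one] at h
          exact h.symm
        exact ⟨g⁻¹, hinv, Subgroup.inv_mem _ hgμ,
          apply_inv_of_apply_eq_one c hg⟩ }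
  have hAstab : ∀ (s : Field.absoluteGaloisGroup K), ∀ m ∈ A, ρ s m ∈ A := by
    rintro s _ ⟨g, hg, hgμ, rfl⟩
    refine ⟨s * g * s⁻¹, ?_, conj_mem_rootsOfUnityFixer hgμ s, apply_conj_of_apply_eq_one c hg s⟩
    rw [map_mul, map_mul, hg, mul_one, ← map_mul, mul_inv_cancel, map_one]
  have hAle : A ≤ ((ρ τ).toAddMonoidHom - AddMonoidHom.id M).range := by
    rintro _ ⟨g, hg, hgμ, rfl⟩
    exact hc g hg hgμ
  have hAbot : A = ⊥ := by
    rcases hirr A hAstab with h | h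
    · exact h
    · exact absurd (top_le_iff.mp (h ▸ hAle)) (range_sub_id_ne_top e)
  refine hH3 c fun u hu hμ => ?_
  have hmem : c.1 u ∈ A := ⟨u, hu, hμ, rfl⟩
  rw [hAbot] at hmem
  exact (AddSubgroup.mem_bot).mp hmem

/-! ## The selection -/

/-- `c(τ γ) ≡ c(τ) + c(γ) (mod (τ − 1)T̄)` for EVERY `γ`: `c(τγ) = c(τ) + τ·c(γ)` and
`τ m − m ∈ (τ − 1)T̄`. [cite: MazurRubin2004, Prop. 3.6.1 proof, p. 31] -/
theorem mk_apply_mul_eq (τ γ : Field.absoluteGaloisGroup K) (c : contOneCocycles ρ.toTopRep) :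
    (QuotientAddGroup.mk (c.1 (τ * γ)) : cokerSubOne ρ τ) =
      QuotientAddGroup.mk (c.1 τ) + QuotientAddGroup.mk (c.1 γ) := by
  rw [c.2 τ γ, QuotientAddGroup.mk_add]
  congr 1
  change (QuotientAddGroup.mk (ρ τ (c.1 γ)) : cokerSubOne ρ τ) = _
  rw [QuotientAddGroup.eq_iff_sub_mem]
  exact ⟨c.1 γ, rfl⟩

/-- **THE SELECTION** (Sakamoto, JTNB 36 (2024), Lemma 5.2, group-theoretic half; Mazur–Rubin
Prop. 3.6.1, proof, p. 31, with `4 · (1/p) < 1` replaced by file 1's covering lemma).  Let `K` be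
any field, `ρ` a discrete `Γ_K`-module on `M` (= `T̄`), `N : ℕ`, `τ ∈ Γ_K` with
`T̄/(τ − 1)T̄ ≃ ℤ/p`, and assume (H.1) (no `ρ`-stable subgroup other than `⊥, ⊤`) and (H.3)
(crossed homomorphisms vanishing on `G_F = ker ρ ⊓ Gal(K̄/K(μ_N))` are principal, the shape of
`InflationRestrictionSakamotoH3`).  Then for any `n ≤ p` continuous crossed homomorphisms
`c₁, …, cₙ : Γ_K → T̄` with NON-ZERO classes there is `γ ∈ G_F` with
`cᵢ(τ γ) ∉ (τ − 1)T̄` for every `i`.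
[cite: Sakamoto2024, Lemma 5.2 (p. 928)] [cite: MazurRubin2004, Prop. 3.6.1 proof, p. 31] -/
theorem exists_forall_apply_mul_notMem_range {p : ℕ} [Fact p.Prime] {N : ℕ}
    {τ : Field.absoluteGaloisGroup K} (e : cokerSubOne ρ τ ≃+ ZMod p)
    (hirr : ∀ A : AddSubgroup M,
      (∀ (s : Field.absoluteGaloisGroup K), ∀ m ∈ A, ρ s m ∈ A) → A = ⊥ ∨ A = ⊤)
    (hH3 : ∀ f : contOneCocycles ρ.toTopRep,
      (∀ u : Field.absoluteGaloisGroup K, ρ u = 1 → u ∈ rootsOfUnityFixer K N → f.1 u = 0) →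
        oneCocycleClass ρ.toTopRep f = 0)
    {n : ℕ} (hn : n ≤ p) (c : Fin n → contOneCocycles ρ.toTopRep)
    (hc : ∀ i, oneCocycleClass ρ.toTopRep (c i) ≠ 0) :
    ∃ γ : Field.absoluteGaloisGroup K, ρ γ = 1 ∧ γ ∈ rootsOfUnityFixer K N ∧
      ∀ i, (c i).1 (τ * γ) ∉ ((ρ τ).toAddMonoidHom - AddMonoidHom.id M).range := by
  classical
  -- the group `G_F = ker ρ ⊓ Gal(K̄/K(μ_N))` as a subgroup
  set GF : Subgroup (Field.absoluteGaloisGroup K) := ρ.ker ⊓ rootsOfUnityFixer K N with hGF_def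
  have hmemGF : ∀ g : Field.absoluteGaloisGroup K, g ∈ GF ↔ ρ g = 1 ∧ g ∈ rootsOfUnityFixer K N :=
    fun g => by rw [hGF_def, Subgroup.mem_inf, ContinuousRep.mem_ker]; exact Iff.rfl
  set R : AddSubgroup M := ((ρ τ).toAddMonoidHom - AddMonoidHom.id M).range with hR_def
  -- `π = e ∘ (mod (τ − 1)T̄) : T̄ → 𝔽_p`
  let π : M →+ ZMod p := e.toAddMonoidHom.comp (QuotientAddGroup.mk' R)
  have hπ : ∀ m, π m = e (QuotientAddGroup.mk m) := fun m => rfl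
  have hπ0 : ∀ m, π m = 0 ↔ m ∈ R := fun m => by
    rw [hπ, e.map_eq_zero_iff, QuotientAddGroup.eq_zero_iff]
  -- the data of file 1's selection lemma
  let E : Fin n → (↥GF → ZMod p) := fun i g => π ((c i).1 g)
  let F : (Fin n → ZMod p) →ₗ[ZMod p] (↥GF → ZMod p) := Fintype.linearCombination (ZMod p) E
  let Λ : (Fin n → ZMod p) →ₗ[ZMod p] ZMod p :=
    Fintype.linearCombination (ZMod p) fun i => π ((c i).1 τ)
  have hFapply : ∀ a (g : GF), F a g = ∑ i, a i * π ((c i).1 g) := fun a g => by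
    change (Fintype.linearCombination (ZMod p) E a) g = _
    rw [Fintype.linearCombination_apply, Finset.sum_apply]
    simp only [Pi.smul_apply, smul_eq_mul, E]
  have hΛapply : ∀ a, Λ a = ∑ i, a i * π ((c i).1 τ) := fun a => by
    change Fintype.linearCombination (ZMod p) _ a = _
    rw [Fintype.linearCombination_apply]
    simp only [smul_eq_mul]
  -- the integral combination `ψ_a = Σ ãᵢ cᵢ` realising `a`
  have hcomb : ∀ (a : Fin n → ZMod p) (g : Field.absoluteGaloisGroup K),
      π ((∑ i, (a i).val • c i : contOneCocycles ρ.toTopRep).1 g) = ∑ i, a i * π ((c i).1 g) := by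
    intro a g
    let ev : contOneCocycles ρ.toTopRep →+ M :=
      { toFun := fun ψ => ψ.1 g, map_zero' := rfl, map_add' := fun _ _ => rfl }
    have h1 : (∑ i, (a i).val • c i : contOneCocycles ρ.toTopRep).1 g =
        ∑ i, (a i).val • (c i).1 g := by
      change ev (∑ i, (a i).val • c i) = ∑ i, (a i).val • ev (c i)
      rw [map_sum]
      exact Finset.sum_congr rfl fun i _ => map_nsmul ev _ _
    rw [h1, map_sum]
    refine Finset.sum_congr rfl fun i _ => ?_
    rw [map_nsmul, nsmul_eq_mul, ZMod.natCast_zmod_val]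
  -- each `F a` is a homomorphism on `G_F`
  have hFmul : ∀ a (g h : GF), F a (g * h) = F a g + F a h := by
    intro a g h
    rw [hFapply, hFapply, hFapply, ← Finset.sum_add_distrib]
    refine Finset.sum_congr rfl fun i _ => ?_
    rw [Subgroup.coe_mul, apply_mul_of_apply_eq_one (c i) ((hmemGF g).mp g.2).1, map_add, mul_add]
  -- compatibility `F a = 0 → Λ a = 0` (key lemma applied to `ψ_a`)
  have hFΛ : ∀ a, F a = 0 → Λ a = 0 := by
    intro a ha
    set ψ : contOneCocycles ρ.toTopRep := ∑ i, (a i).val • c i with hψ_def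
    have hψ : oneCocycleClass ρ.toTopRep ψ = 0 := by
      refine oneCocycleClass_eq_zero_of_forall_apply_mem_range e hirr hH3 ψ fun g hg hgμ => ?_
      rw [← hπ0, hψ_def, hcomb]
      have := congrFun ha ⟨g, (hmemGF g).mpr ⟨hg, hgμ⟩⟩
      rwa [hFapply] at this
    obtain ⟨v, hv⟩ := (oneCocycleClass_eq_zero_iff _ ψ).mp hψ
    rw [hΛapply, ← hcomb, ← hψ_def, hπ0, hv τ]
    exact ⟨v, rfl⟩
  -- non-degeneracy `F eᵢ ≠ 0` (key lemma applied to `cᵢ`)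
  have hFne : ∀ i, F (Pi.single i 1) ≠ 0 := by
    intro i h0
    refine hc i (oneCocycleClass_eq_zero_of_forall_apply_mem_range e hirr hH3 (c i) ?_)
    intro g hg hgμ
    rw [← hπ0]
    have := congrFun h0 ⟨g, (hmemGF g).mpr ⟨hg, hgμ⟩⟩
    change (Fintype.linearCombination (ZMod p) E (Pi.single i 1)) _ = 0 at this
    rwa [Fintype.linearCombination_apply_single, one_smul] at this
  -- file 1
  obtain ⟨g, hg⟩ := exists_forall_apply_add_ne_zero hn F hFmul Λ hFΛ hFne
  refine ⟨g, ((hmemGF g).mp g.2).1, ((hmemGF g).mp g.2).2, fun i hi => ?_⟩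
  apply hg i
  have h1 : F (Pi.single i 1) g = π ((c i).1 g) := by
    change (Fintype.linearCombination (ZMod p) E (Pi.single i 1)) g = _
    rw [Fintype.linearCombination_apply_single, one_smul]
  have h2 : Λ (Pi.single i 1) = π ((c i).1 τ) := by
    change Fintype.linearCombination (ZMod p) _ (Pi.single i 1) = _
    rw [Fintype.linearCombination_apply_single, one_smul]
  rw [h1, h2, add_comm, hπ, hπ, ← map_add, ← mk_apply_mul_eq τ _ (c i), ← hπ, hπ0]
  exact hi

end Summit.BirchSwinnertonDyer.Rank1Residual.GaloisImage.PrimeChoice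

end
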